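import Summits.Ventures.PercRepro.GenQFrameDiag

/-!
# PercRepro — the diagonal wrapper descends to the FULL core (`e`-free partitions included) (night-4, gen 2)

`rls_diag` (`GenQFrameDiag.lean`) reduces the row `(q + 3, q + 1)` on every finite matroid to its simple, rank-`(q + 3)`,
coloop-free core, given the previous diagonal row `(q + 2, q)`.  night-1's full-level wrapper `rls_succ_all` hands its core
one more clause — every element `e` admits an `e`-FREE PARTITION `E ∖ e = A ⊔ A′` with `e ∉ cl A`, `e ∉ cl A′` — through
`RLS_of_unspanned_q`, which needs the previous LEVEL at the rank `p − 1`.  On the diagonal that is exactly the previous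
diagonal row on `M ／ e`, so the clause is free here too: `rls_diag_core` is `rls_diag` with the core of night-3's
`Core M (q + 3)` (`RLSRulePlus.lean`, spelled out clause by clause so that this file needs no new olean).  It lets the
Core-typed per-flat statements (`OpenLayersCore q`, `GenQOpenLayersCore.lean`) land the row on EVERY finite matroid.
-/

open scoped Matroid

namespace PercRepro.GenQ

open Finset ThmH ThmN

variable {α : Type}

/-- **The diagonal wrapper with the full core** (`rls_diag` plus the `e`-free partition clause): `C025` at `(q + 2, q)`
on every finite matroid and the simple, rank-`(q + 3)`, coloop-free core in which every element admits an `e`-free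
partition at `(q + 3, q + 1)` give `C025` at `(q + 3, q + 1)` on every finite matroid.  An element without an `e`-free
partition closes the step by `RLS_of_unspanned_q` from `M ＼ e` (fewer elements) and `M ／ e` (the previous row). -/
theorem rls_diag_core (q : ℕ)
    (hprev : ∀ (M : Matroid α) [M.Finite], RLS M (q + 2) q)
    (hcore : ∀ (M : Matroid α) [M.Finite],
      (∀ e ∈ M.E, ∀ f ∈ M.E, e ≠ f → M.eRk {e, f} = 2) → M.eRank = ((q + 3 : ℕ) : ℕ∞) →
      (∀ e, ¬ M.IsColoop e) →
      (∀ e ∈ M.E, ∃ A ⊆ M.E \ {e}, e ∉ M.closure A ∧ e ∉ M.closure ((M.E \ {e}) \ A)) →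
      RLS M (q + 3) (q + 1)) :
    ∀ (M : Matroid α) [M.Finite], RLS M (q + 3) (q + 1) := by
  suffices H : ∀ n : ℕ, ∀ (M : Matroid α) [M.Finite], M.E.ncard = n → RLS M (q + 3) (q + 1) from
    fun M _ => H _ M rfl
  intro n
  induction n using Nat.strong_induction_on with
  | _ n ih =>
  intro M _ hn
  classical
  have hdel : ∀ e ∈ M.E, (M ＼ {e}).E.ncard < n := by
    intro e he
    rw [_root_.Matroid.delete_ground, ← hn, ← Set.ncard_sdiff_singleton_add_one he M.ground_finite]
    omega
  -- Case 1: a loop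
  by_cases hL : ∃ e ∈ M.E, M.IsLoop e
  · obtain ⟨e, he, hloopE⟩ := hL
    exact RLS_of_loop_q M hloopE (q + 3) (q + 1) (ih _ (hdel e he) (M ＼ {e}) rfl)
  push Not at hL
  -- Case 2: a parallel pair
  by_cases hP : ∃ e ∈ M.E, ∃ e' ∈ M.E, e' ≠ e ∧ e ∈ M.closure {e'}
  · obtain ⟨e, he, e', he', hne, hpar⟩ := hP
    have heI : M.Indep {e} :=
      _root_.Matroid.indep_singleton.2 ((_root_.Matroid.not_isLoop_iff he).1 (hL e he))
    exact RLS_of_parallel_q M (p := q + 2) (q := q) heI he' hne hpar (ih _ (hdel e he) (M ＼ {e}) rfl)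
      (hprev (M ／ {e}))
  push Not at hP
  -- Case 3: simple
  have hs : ∀ e ∈ M.E, ∀ f ∈ M.E, e ≠ f → M.eRk {e, f} = 2 :=
    fun e he f hf hef => eRk_pair_eq_two_of_simple M hL (fun e he e' he' hne => hP e he e' he' hne) he hf hef
  rcases lt_trichotomy M.eRank ((q + 3 : ℕ) : ℕ∞) with hlt | heq | hgt
  · exact RLS_of_eRank_lt M hlt
  · -- `r(E) = q + 3`
    by_cases hC : ∃ e, M.IsColoop e
    · obtain ⟨e, hcol⟩ := hC
      refine RLS_of_coloop_q M (p := q + 2) (q := q) (by omega) hcol heq ?_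
      exact RLS_of_le (M ＼ {e}) (by omega)
    · push Not at hC
      -- an element without an `e`-free partition closes the step
      by_cases hU : ∃ e ∈ M.E, ∀ A ⊆ M.E \ {e}, e ∈ M.closure A ∨ e ∈ M.closure ((M.E \ {e}) \ A)
      · obtain ⟨e, he, hunsp⟩ := hU
        have heI : M.Indep {e} :=
          _root_.Matroid.indep_singleton.2 ((_root_.Matroid.not_isLoop_iff he).1 (hL e he))
        exact RLS_of_unspanned_q M (p := q + 2) (q := q) heI hunsp (ih _ (hdel e he) (M ＼ {e}) rfl)
          (hprev (M ／ {e}))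
      · push Not at hU
        exact hcore M hs heq hC (fun e he => by
          obtain ⟨A, hA, h⟩ := hU e he
          exact ⟨A, hA, h.1, h.2⟩)
  · -- `r(E) > q + 3`: truncate to rank `q + 3` (same ground set), then the same dichotomy on the truncation
    set T := Matroid.truncate M (q + 3) with hTdef
    have hTs := truncate_pair_eRk M (p := q + 3) (by omega) hs
    have hTR := truncate_eRank_eq M hgt
    have hTc := truncate_no_coloop M hgt
    have hTE : T.E = M.E := Matroid.truncate_ground M (q + 3)
    have hT : RLS T (q + 3) (q + 1) := by
      by_cases hU : ∃ e ∈ T.E, ∀ A ⊆ T.E \ {e}, e ∈ T.closure A ∨ e ∈ T.closure ((T.E \ {e}) \ A)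
      · obtain ⟨e, he, hunsp⟩ := hU
        have heT : T.Indep {e} := by
          rw [Matroid.truncate_indep_iff]
          refine ⟨_root_.Matroid.indep_singleton.2
            ((_root_.Matroid.not_isLoop_iff (hTE ▸ he)).1 (hL e (hTE ▸ he))), ?_⟩
          rw [Set.ncard_singleton]; omega
        have hdelT : (T ＼ {e}).E.ncard < n := by
          rw [_root_.Matroid.delete_ground, hTE, ← hn,
            ← Set.ncard_sdiff_singleton_add_one (hTE ▸ he) M.ground_finite]
          omega
        exact RLS_of_unspanned_q T (p := q + 2) (q := q) heT hunsp (ih _ hdelT (T ＼ {e}) rfl) (hprev (T ／ {e}))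
      · push Not at hU
        exact hcore T hTs hTR hTc (fun e he => by
          obtain ⟨A, hA, h⟩ := hU e he
          exact ⟨A, hA, h.1, h.2⟩)
    unfold RLS at hT ⊢
    exact Matroid.rls_of_truncate M (q + 3) (by omega) (phiK (q + 3) (q + 1)) (by unfold phiK; positivity) hT

end PercRepro.GenQ
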